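import Summits.AtomisticToContinuum.Crystallization.Theorems.SquareWellLayerCakeGapTwelveToBarlowFiveRingCensusExtract
import Literature.Geometry.DiscreteGeometry.KissingRigidity

/-!
# The five-fold continuation stubs from the one-shell link census (skeleton v5, `stub_fiveFoldOfCensus`)

Crux `SquareWellLayerCake.GapTwelveToBarlow` (stmt-AtomisticToContinuum-15807), line `Sketch`.
Skeleton v5 funnels the one-shell input of card A through ONE stub, the LINK CENSUS (S3δ): at a
Good site with the local `131/100` dichotomy the contact graph of the twelve neighbours is, in
some labelling `e : Fin 12 → Fin N`, the cuboctahedral graph `fccAdj`, the anticuboctahedral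
graph `hcpAdj` (`Literature/Geometry/DiscreteGeometry/KissingRigidity.lean`) or the bicapped
pentagonal prism `bppAdj` (`…FiveRingCensusDefs`).  This file proves the registered glue stub

* `stub_fiveFoldOfCensus : (S3δ) → (stub_fiveFoldNoAdjacent) ∧ (stub_fiveFoldExists)`:

a five-fold bond `(j, k)` makes the label of `k` a vertex of contact degree five
(`degree_eq_of_labelling`, transporting common-neighbour counts through the labelling as in
`card_common_eq_card_bonded`); the fcc and hcp graphs are `4`-regular (`fcc_degree`,
`hcp_degree`, by `decide`), so the link is the bicapped pentagonal prism, whose degree-five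
vertices are exactly the two poles `0`, `11` (`bpp_degree_five_iff`), and the poles are not
adjacent (`bpp_poles_not_adj'` of `…FiveRingCensusSound`): hence a second five-fold bond exists (the other pole) and two
five-fold bonds are never bonded.  Pure finite combinatorics on top of the landed extraction
lemmas; Mathlib + tree files only, no named fact.
-/

noncomputable section

namespace Summit.AtomisticToContinuum.Crystallization.Theorems.SquareWellLayerCakeGapTwelveToBarlow

open Literature.Geometry.DiscreteGeometry Finset

/-! ### Degrees of the three pattern graphs -/

/-- The cuboctahedral contact graph is `4`-regular. [folklore] -/
theorem fcc_degree (a : Fin 12) : (univ.filter fun b : Fin 12 => b ≠ a ∧ fccAdj a b).card = 4 := by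
  revert a; decide

/-- The anticuboctahedral contact graph is `4`-regular. [folklore] -/
theorem hcp_degree (a : Fin 12) : (univ.filter fun b : Fin 12 => b ≠ a ∧ hcpAdj a b).card = 4 := by
  revert a; decide

/-- In the bicapped pentagonal prism the vertices of degree five are exactly the poles `0`, `11`. -/
theorem bpp_degree_five_iff (a : Fin 12) :
    (univ.filter fun b : Fin 12 => b ≠ a ∧ bppAdj a b = true).card = 5 ↔ (a = 0 ∨ a = 11) := by
  revert a; decide

/-! ### Labellings of the twelve neighbours -/

/-- An injective labelling of twelve neighbours of a site with exactly twelve neighbours is onto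
the neighbourhood. [folklore] -/
theorem labelling_surj {N : ℕ} (x : Fin N → EuclideanSpace ℝ (Fin 3)) (j : Fin N)
    (hN : (univ.filter fun j' : Fin N => j' ≠ j ∧ dist (x j) (x j') ≤ 1).card = 12)
    {e : Fin 12 → Fin N} (hinj : Function.Injective e)
    (hNb : ∀ m, e m ≠ j ∧ dist (x j) (x (e m)) ≤ 1) :
    ∀ l : Fin N, l ≠ j → dist (x j) (x l) ≤ 1 → ∃ m, e m = l := by
  classical
  intro l hlj hjl
  have hsub : (univ.image e) ⊆ (univ.filter fun j' : Fin N => j' ≠ j ∧ dist (x j) (x j') ≤ 1) := by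
    intro l' hl'
    obtain ⟨m, -, rfl⟩ := mem_image.1 hl'
    exact mem_filter.2 ⟨mem_univ _, hNb m⟩
  have hcard : (univ.image e).card = 12 := by
    rw [card_image_of_injective _ hinj, card_univ, Fintype.card_fin]
  have heq : (univ.image e) = (univ.filter fun j' : Fin N => j' ≠ j ∧ dist (x j) (x j') ≤ 1) :=
    eq_of_subset_of_card_le hsub (by rw [hcard, hN])
  have hl : l ∈ univ.image e := by
    rw [heq]; exact mem_filter.2 ⟨mem_univ _, hlj, hjl⟩
  obtain ⟨m, -, hm⟩ := mem_image.1 hl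
  exact ⟨m, hm⟩

/-- **Common-neighbour counts are contact degrees of labels.**  For a labelling `e` of the
neighbours of `j` whose bonds realise the graph `G`, the number of common neighbours of `j` and
`e m` is the `G`-degree of `m`. -/
theorem degree_eq_of_labelling {N : ℕ} (x : Fin N → EuclideanSpace ℝ (Fin 3)) (j : Fin N)
    {e : Fin 12 → Fin N} (hinj : Function.Injective e)
    (hNb : ∀ m, e m ≠ j ∧ dist (x j) (x (e m)) ≤ 1)
    (hsurj : ∀ l : Fin N, l ≠ j → dist (x j) (x l) ≤ 1 → ∃ m, e m = l)
    (G : Fin 12 → Fin 12 → Prop) [DecidableRel G]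
    (hG : ∀ a b : Fin 12, a ≠ b → (dist (x (e a)) (x (e b)) ≤ 1 ↔ G a b)) (m : Fin 12) :
    (univ.filter fun l : Fin N =>
        l ≠ j ∧ l ≠ e m ∧ dist (x j) (x l) ≤ 1 ∧ dist (x (e m)) (x l) ≤ 1).card =
      (univ.filter fun m' : Fin 12 => m' ≠ m ∧ G m m').card := by
  classical
  rw [card_common_eq_card_bonded x j hinj hNb hsurj m]
  congr 1
  ext m'
  simp only [mem_filter, mem_univ, true_and, dist_sub_right]
  constructor
  · rintro ⟨hne, hd⟩
    exact ⟨hne, (hG m m' (Ne.symm hne)).1 hd⟩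
  · rintro ⟨hne, hg⟩
    exact ⟨hne, (hG m m' (Ne.symm hne)).2 hg⟩

/-- **The BPP case is forced by a five-fold bond, and its poles give everything.**  From a
labelling realising one of the three pattern graphs and a label `a` of contact degree five:
the graph is the bicapped pentagonal prism, `a` is a pole, there is a second label of degree
five, and any two distinct labels of degree five are not bonded. -/
theorem poles_of_linkCensus {N : ℕ} (x : Fin N → EuclideanSpace ℝ (Fin 3)) (j : Fin N)
    {e : Fin 12 → Fin N} (hinj : Function.Injective e)
    (hNb : ∀ m, e m ≠ j ∧ dist (x j) (x (e m)) ≤ 1)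
    (hsurj : ∀ l : Fin N, l ≠ j → dist (x j) (x l) ≤ 1 → ∃ m, e m = l)
    (hG : (∀ a b : Fin 12, a ≠ b → (dist (x (e a)) (x (e b)) ≤ 1 ↔ fccAdj a b)) ∨
      (∀ a b : Fin 12, a ≠ b → (dist (x (e a)) (x (e b)) ≤ 1 ↔ hcpAdj a b)) ∨
      (∀ a b : Fin 12, a ≠ b → (dist (x (e a)) (x (e b)) ≤ 1 ↔ bppAdj a b = true)))
    (a : Fin 12)
    (ha : (univ.filter fun l : Fin N =>
        l ≠ j ∧ l ≠ e a ∧ dist (x j) (x l) ≤ 1 ∧ dist (x (e a)) (x l) ≤ 1).card = 5) :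
    (∃ a' : Fin 12, a' ≠ a ∧ (univ.filter fun l : Fin N =>
        l ≠ j ∧ l ≠ e a' ∧ dist (x j) (x l) ≤ 1 ∧ dist (x (e a')) (x l) ≤ 1).card = 5) ∧
    (∀ a' : Fin 12, a' ≠ a → (univ.filter fun l : Fin N =>
        l ≠ j ∧ l ≠ e a' ∧ dist (x j) (x l) ≤ 1 ∧ dist (x (e a')) (x l) ≤ 1).card = 5 →
        1 < dist (x (e a)) (x (e a'))) := by
  classical
  rcases hG with hG | hG | hG
  · rw [degree_eq_of_labelling x j hinj hNb hsurj (fun a b => fccAdj a b) hG a, fcc_degree] at ha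
    exact absurd ha (by norm_num)
  · rw [degree_eq_of_labelling x j hinj hNb hsurj (fun a b => hcpAdj a b) hG a, hcp_degree] at ha
    exact absurd ha (by norm_num)
  · have hdeg : ∀ m : Fin 12, (univ.filter fun l : Fin N =>
        l ≠ j ∧ l ≠ e m ∧ dist (x j) (x l) ≤ 1 ∧ dist (x (e m)) (x l) ≤ 1).card =
        (univ.filter fun m' : Fin 12 => m' ≠ m ∧ bppAdj m m' = true).card := fun m =>
      degree_eq_of_labelling x j hinj hNb hsurj (fun a b => bppAdj a b = true) hG m
    have hpole : a = 0 ∨ a = 11 := (bpp_degree_five_iff a).1 (by rw [← hdeg a]; exact ha)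
    refine ⟨?_, ?_⟩
    · -- the other pole
      rcases hpole with rfl | rfl
      · refine ⟨11, by decide, ?_⟩
        rw [hdeg 11]; exact (bpp_degree_five_iff 11).2 (Or.inr rfl)
      · refine ⟨0, by decide, ?_⟩
        rw [hdeg 0]; exact (bpp_degree_five_iff 0).2 (Or.inl rfl)
    · intro a' ha'a ha'
      have hpole' : a' = 0 ∨ a' = 11 := (bpp_degree_five_iff a').1 (by rw [← hdeg a']; exact ha')
      have hnadj : bppAdj a a' = false := bpp_poles_not_adj' a a' hpole hpole' (Ne.symm ha'a)
      have hnb : ¬ dist (x (e a)) (x (e a')) ≤ 1 := by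
        intro hd
        have := (hG a a' (Ne.symm ha'a)).1 hd
        rw [hnadj] at this
        exact Bool.false_ne_true this
      exact lt_of_not_ge hnb

/-! ### The registered glue stub -/

/-- **`stub_fiveFoldOfCensus` (skeleton v5 of line `Sketch`, registered):** the one-shell link
census (S3δ) implies the two five-fold continuation stubs — no two five-fold bonds at a Good site
with the local `131/100` dichotomy are bonded to each other (`stub_fiveFoldNoAdjacent`), and a
five-fold bond has a partner (`stub_fiveFoldExists`). -/
theorem stub_fiveFoldOfCensus :
    (∀ (N : ℕ) (x : Fin N → EuclideanSpace ℝ (Fin 3)) (j : Fin N), ((∀ j' : Fin N, dist (x j) (x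
    j') ≤ 11 / 10 → ∀ k' : Fin N, k' ≠ j' → (55 : ℝ) / 57 ≤ dist (x j') (x k')) ∧
    (Finset.univ.filter fun j' : Fin N => j' ≠ j ∧ dist (x j) (x j') ≤ 1).card = 12 ∧
    (Finset.univ.filter fun j' : Fin N => j' ≠ j ∧ dist (x j) (x j') ≤ 11 / 10).card ≤ 12) → (∀ l
    l' : Fin N, dist (x j) (x l) ≤ 1 → dist (x j) (x l') ≤ 1 → 1 < dist (x l) (x l') → (131 : ℝ) /
    100 ≤ dist (x l) (x l')) → ∃ e : Fin 12 → Fin N, Function.Injective e ∧ (∀ a : Fin 12, e a ≠ j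
    ∧ dist (x j) (x (e a)) ≤ 1) ∧ ((∀ a b : Fin 12, a ≠ b → (dist (x (e a)) (x (e b)) ≤ 1 ↔
    Literature.Geometry.DiscreteGeometry.fccAdj a b)) ∨ (∀ a b : Fin 12, a ≠ b → (dist (x (e a)) (x
    (e b)) ≤ 1 ↔ Literature.Geometry.DiscreteGeometry.hcpAdj a b)) ∨ (∀ a b : Fin 12, a ≠ b → (dist
    (x (e a)) (x (e b)) ≤ 1 ↔
    Summit.AtomisticToContinuum.Crystallization.Theorems.SquareWellLayerCakeGapTwelveToBarlow.bppAdj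
    a b = true)))) → (∀ (N : ℕ) (x : Fin N → EuclideanSpace ℝ (Fin 3)) (j k : Fin N), ((∀ j' : Fin
    N, dist (x j) (x j') ≤ 11 / 10 → ∀ k' : Fin N, k' ≠ j' → (55 : ℝ) / 57 ≤ dist (x j') (x k')) ∧
    (Finset.univ.filter fun j' : Fin N => j' ≠ j ∧ dist (x j) (x j') ≤ 1).card = 12 ∧
    (Finset.univ.filter fun j' : Fin N => j' ≠ j ∧ dist (x j) (x j') ≤ 11 / 10).card ≤ 12) → (∀ l
    l' : Fin N, dist (x j) (x l) ≤ 1 → dist (x j) (x l') ≤ 1 → 1 < dist (x l) (x l') → (131 : ℝ) /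
    100 ≤ dist (x l) (x l')) → j ≠ k → dist (x j) (x k) ≤ 1 → (Finset.univ.filter fun l : Fin N =>
    l ≠ j ∧ l ≠ k ∧ dist (x j) (x l) ≤ 1 ∧ dist (x k) (x l) ≤ 1).card = 5 → ∀ k' : Fin N, k' ≠ j →
    k' ≠ k → dist (x j) (x k') ≤ 1 → (Finset.univ.filter fun l : Fin N => l ≠ j ∧ l ≠ k' ∧ dist (x
    j) (x l) ≤ 1 ∧ dist (x k') (x l) ≤ 1).card = 5 → 1 < dist (x k) (x k')) ∧ (∀ (N : ℕ) (x : Fin N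
    → EuclideanSpace ℝ (Fin 3)) (j k : Fin N), ((∀ j' : Fin N, dist (x j) (x j') ≤ 11 / 10 → ∀ k' :
    Fin N, k' ≠ j' → (55 : ℝ) / 57 ≤ dist (x j') (x k')) ∧ (Finset.univ.filter fun j' : Fin N => j'
    ≠ j ∧ dist (x j) (x j') ≤ 1).card = 12 ∧ (Finset.univ.filter fun j' : Fin N => j' ≠ j ∧ dist (x
    j) (x j') ≤ 11 / 10).card ≤ 12) → (∀ l l' : Fin N, dist (x j) (x l) ≤ 1 → dist (x j) (x l') ≤ 1
    → 1 < dist (x l) (x l') → (131 : ℝ) / 100 ≤ dist (x l) (x l')) → j ≠ k → dist (x j) (x k) ≤ 1 →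
    (Finset.univ.filter fun l : Fin N => l ≠ j ∧ l ≠ k ∧ dist (x j) (x l) ≤ 1 ∧ dist (x k) (x l) ≤
    1).card = 5 → ∃ k' : Fin N, k' ≠ j ∧ k' ≠ k ∧ dist (x j) (x k') ≤ 1 ∧ (Finset.univ.filter fun l
    : Fin N => l ≠ j ∧ l ≠ k' ∧ dist (x j) (x l) ≤ 1 ∧ dist (x k') (x l) ≤ 1).card = 5) := by
  intro hcensus
  refine ⟨?_, ?_⟩
  · intro N x j k hGood hD hjk hk hR5 k' hk'j hk'k hk' hR5'
    obtain ⟨e, hinj, hNb, hG⟩ := hcensus N x j hGood hD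
    have hsurj := labelling_surj x j hGood.2.1 hinj hNb
    obtain ⟨a, rfl⟩ := hsurj k hjk.symm hk
    obtain ⟨a', rfl⟩ := hsurj k' hk'j hk'
    have ha'a : a' ≠ a := fun h => hk'k (by rw [h])
    exact (poles_of_linkCensus x j hinj hNb hsurj hG a hR5).2 a' ha'a hR5'
  · intro N x j k hGood hD hjk hk hR5
    obtain ⟨e, hinj, hNb, hG⟩ := hcensus N x j hGood hD
    have hsurj := labelling_surj x j hGood.2.1 hinj hNb
    obtain ⟨a, rfl⟩ := hsurj k hjk.symm hk
    obtain ⟨⟨a', ha'a, ha'⟩, -⟩ := poles_of_linkCensus x j hinj hNb hsurj hG a hR5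
    exact ⟨e a', (hNb a').1, fun h => ha'a (hinj h), (hNb a').2, ha'⟩

end Summit.AtomisticToContinuum.Crystallization.Theorems.SquareWellLayerCakeGapTwelveToBarlow

end
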